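import Summits.QuantumFields.QCD.Theses.HeatSlicedQuarks
import Summits.QuantumFields.QCD.Theorems.HeatSlicedQuarksQuarkLoopCoefficientDefs
import Summits.QuantumFields.QCD.Theorems.HeatSlicedQuarksQuarkLoopCoefficientHeatSeries
import Summits.QuantumFields.QCD.Theorems.HeatSlicedQuarksQuarkLoopCoefficientFreeMajorantToolkitAux

/-!
# Second-order expansion of the heat symbol — part A: elementary estimates
(line `Sketch` of crux stmt-QuantumFields-16786, stub `stub_secondOrderExpansion`, helper file)

Elementary inequalities used by the flux expansion of the symmetric-gauge heat symbol:

* coordinates and lengths on the neighbourhoods `nbr 0`, `nbr2 0`; bounds of the symplectic weight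
  `wedge` (`|z ∧ v| ≤ 4`, `|v ∧ w| ≤ 4|w|`);
* the profile `gaussProfile` at the origin, its monotonicity in time on bounded intervals;
* the sharp polynomial Taylor bound of the cocycle, `‖e^{iφ} − Σ_{j<m} (iφ)ʲ/j!‖ ≤ |φ|ᵐ` (real `φ`).
-/

noncomputable section

namespace Summit.QuantumFields.QCD.Cruxes.QuarkLoopCoefficient.Sketch.SecondOrderExpansion

open Literature.MathematicalPhysics.QuantumLattice Literature.MathematicalPhysics.QuantumFieldTheory
open Literature.Probability.LatticeModels (Site)
open Summit.QuantumFields.QCD.Theorems.QuarkLoopCoefficient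
open Summit.QuantumFields.QCD.Cruxes.QuarkLoopCoefficient.Sketch.HeatSeries
open Summit.QuantumFields.QCD.Cruxes.QuarkLoopCoefficient.Sketch.FreeMajorantToolkit
open scoped Matrix ComplexConjugate

/-! ## §1 Coordinates on the neighbourhoods and the symplectic weight -/

/-- Points of `nbr 0` have coordinates in `{−1, 0, 1}`. -/
theorem abs_apply_le_one_of_mem_nbr {z : Site 4} (hz : z ∈ nbr 0) (μ : Fin 4) : |z μ| ≤ 1 := by
  rcases mem_nbr.mp hz with h | ⟨ν, h | h⟩
  · simp [h]
  · rw [h, zero_add, Pi.single_apply]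
    split_ifs <;> simp
  · rw [h, zero_sub, Pi.neg_apply, abs_neg, Pi.single_apply]
    split_ifs <;> simp

/-- Points of `nbr2 0` have coordinates in `{−2, …, 2}`. -/
theorem abs_apply_le_two_of_mem_nbr2 {v : Site 4} (hv : v ∈ nbr2 0) (μ : Fin 4) : |v μ| ≤ 2 := by
  obtain ⟨z, hz, hvz⟩ := mem_nbr2.mp hv
  have h1 := abs_apply_le_one_of_mem_nbr hz μ
  rcases mem_nbr.mp hvz with h | ⟨ν, h | h⟩
  · rw [h]; omega
  · rw [h, Pi.add_apply, Pi.single_apply]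
    split_ifs
    · calc |z μ + 1| ≤ |z μ| + |(1 : ℤ)| := abs_add_le _ _
        _ ≤ 2 := by simp; omega
    · rw [add_zero]; omega
  · rw [h, Pi.sub_apply, Pi.single_apply]
    split_ifs
    · calc |z μ - 1| ≤ |z μ| + |(1 : ℤ)| := abs_sub _ _
        _ ≤ 2 := by simp; omega
    · rw [sub_zero]; omega

/-- Real form of the coordinate bound on `nbr 0`. -/
theorem abs_cast_apply_le_one_of_mem_nbr {z : Site 4} (hz : z ∈ nbr 0) (μ : Fin 4) :
    |((z μ : ℤ) : ℝ)| ≤ 1 := by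
  have := abs_apply_le_one_of_mem_nbr hz μ
  rw [← Int.cast_abs]; exact_mod_cast this

/-- Real form of the coordinate bound on `nbr2 0`. -/
theorem abs_cast_apply_le_two_of_mem_nbr2 {v : Site 4} (hv : v ∈ nbr2 0) (μ : Fin 4) :
    |((v μ : ℤ) : ℝ)| ≤ 2 := by
  have := abs_apply_le_two_of_mem_nbr2 hv μ
  rw [← Int.cast_abs]; exact_mod_cast this

/-- The unit vectors have length one. -/
theorem elen_single (μ : Fin 4) : elen (Pi.single μ 1) = 1 := by
  unfold elen
  have : ∑ ν : Fin 4, (((Pi.single μ (1 : ℤ) : Site 4) ν : ℤ) : ℝ) ^ 2 = 1 := by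
    simp [Pi.single_apply, Finset.sum_ite_eq']
  rw [this, Real.sqrt_one]

/-- Points of `nbr 0` have length at most one. -/
theorem elen_le_one_of_mem_nbr {z : Site 4} (hz : z ∈ nbr 0) : elen z ≤ 1 := by
  rcases mem_nbr.mp hz with h | ⟨ν, h | h⟩
  · rw [h, elen_zero]; norm_num
  · rw [h, zero_add, elen_single]
  · rw [h, zero_sub, elen_neg, elen_single]

/-- Points of `nbr2 0` have length at most two. -/
theorem elen_le_two_of_mem_nbr2 {v : Site 4} (hv : v ∈ nbr2 0) : elen v ≤ 2 := by
  obtain ⟨z, hz, hvz⟩ := mem_nbr2.mp hv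
  have h1 := elen_le_one_of_mem_nbr hz
  rcases mem_nbr.mp hvz with h | ⟨ν, h | h⟩
  · rw [h]; linarith
  · rw [h]
    calc elen (z + Pi.single ν 1) ≤ elen z + elen (Pi.single ν 1) := elen_add_le _ _
      _ ≤ 2 := by rw [elen_single]; linarith
  · rw [h, sub_eq_add_neg]
    calc elen (z + -Pi.single ν 1) ≤ elen z + elen (-Pi.single ν 1) := elen_add_le _ _
      _ ≤ 2 := by rw [elen_neg, elen_single]; linarith

/-- `v ∧ (a + b) = v ∧ a + v ∧ b`. -/
theorem wedge_add_right (v a b : Site 4) : wedge v (a + b) = wedge v a + wedge v b := by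
  simp only [wedge, Pi.add_apply]; ring

/-- `v ∧ (a − b) = v ∧ a − v ∧ b`. -/
theorem wedge_sub_right (v a b : Site 4) : wedge v (a - b) = wedge v a - wedge v b := by
  simp only [wedge, Pi.sub_apply]; ring

/-- `v ∧ v = 0`. -/
theorem wedge_self (v : Site 4) : wedge v v = 0 := by
  simp only [wedge]; ring

/-- `v ∧ (−w) = −(v ∧ w)`. -/
theorem wedge_neg_right (v w : Site 4) : wedge v (-w) = -wedge v w := by
  simp only [wedge, Pi.neg_apply]; ring

/-- `v ∧ (w − v) = v ∧ w`. -/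
theorem wedge_sub_self_right (v w : Site 4) : wedge v (w - v) = wedge v w := by
  rw [wedge_sub_right, wedge_self, sub_zero]

/-- The weight in coordinates: `v ∧ w = v₀ w₁ − v₁ w₀` (real form). -/
theorem cast_wedge (v w : Site 4) :
    ((wedge v w : ℤ) : ℝ) = ((v 0 : ℤ) : ℝ) * ((w 1 : ℤ) : ℝ) - ((v 1 : ℤ) : ℝ) * ((w 0 : ℤ) : ℝ) := by
  simp only [wedge]; push_cast; ring

/-- `|z ∧ v| ≤ 4` for `z ∈ nbr 0`, `v ∈ nbr2 0`. -/
theorem abs_wedge_le_four {z v : Site 4} (hz : z ∈ nbr 0) (hv : v ∈ nbr2 0) :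
    |((wedge z v : ℤ) : ℝ)| ≤ 4 := by
  rw [cast_wedge]
  have h0 := abs_cast_apply_le_one_of_mem_nbr hz 0
  have h1 := abs_cast_apply_le_one_of_mem_nbr hz 1
  have k0 := abs_cast_apply_le_two_of_mem_nbr2 hv 0
  have k1 := abs_cast_apply_le_two_of_mem_nbr2 hv 1
  calc |((z 0 : ℤ) : ℝ) * ((v 1 : ℤ) : ℝ) - ((z 1 : ℤ) : ℝ) * ((v 0 : ℤ) : ℝ)|
      ≤ |((z 0 : ℤ) : ℝ) * ((v 1 : ℤ) : ℝ)| + |((z 1 : ℤ) : ℝ) * ((v 0 : ℤ) : ℝ)| := abs_sub _ _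
    _ = |((z 0 : ℤ) : ℝ)| * |((v 1 : ℤ) : ℝ)| + |((z 1 : ℤ) : ℝ)| * |((v 0 : ℤ) : ℝ)| := by
        rw [abs_mul, abs_mul]
    _ ≤ 1 * 2 + 1 * 2 := by gcongr
    _ = 4 := by norm_num

/-- `|v ∧ w| ≤ 4 |w|` for `v ∈ nbr2 0`. -/
theorem abs_wedge_le_four_mul_elen {v : Site 4} (hv : v ∈ nbr2 0) (w : Site 4) :
    |((wedge v w : ℤ) : ℝ)| ≤ 4 * elen w := by
  rw [cast_wedge]
  have k0 := abs_cast_apply_le_two_of_mem_nbr2 hv 0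
  have k1 := abs_cast_apply_le_two_of_mem_nbr2 hv 1
  have w0 := abs_apply_le_elen w 0
  have w1 := abs_apply_le_elen w 1
  have he := elen_nonneg w
  calc |((v 0 : ℤ) : ℝ) * ((w 1 : ℤ) : ℝ) - ((v 1 : ℤ) : ℝ) * ((w 0 : ℤ) : ℝ)|
      ≤ |((v 0 : ℤ) : ℝ) * ((w 1 : ℤ) : ℝ)| + |((v 1 : ℤ) : ℝ) * ((w 0 : ℤ) : ℝ)| := abs_sub _ _
    _ = |((v 0 : ℤ) : ℝ)| * |((w 1 : ℤ) : ℝ)| + |((v 1 : ℤ) : ℝ)| * |((w 0 : ℤ) : ℝ)| := by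
        rw [abs_mul, abs_mul]
    _ ≤ 2 * elen w + 2 * elen w := by gcongr
    _ = 4 * elen w := by ring

/-- The total phase weight of the vertex: `|z ∧ v + v ∧ w| ≤ 4 (1 + |w|)`. -/
theorem abs_wedge_add_wedge_le {z v : Site 4} (hz : z ∈ nbr 0) (hv : v ∈ nbr2 0) (w : Site 4) :
    |((wedge z v + wedge v w : ℤ) : ℝ)| ≤ 4 * (1 + elen w) := by
  push_cast
  calc |((wedge z v : ℤ) : ℝ) + ((wedge v w : ℤ) : ℝ)| ≤ |((wedge z v : ℤ) : ℝ)| + |((wedge v w : ℤ) : ℝ)| :=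
        abs_add_le _ _
    _ ≤ 4 + 4 * elen w := add_le_add (abs_wedge_le_four hz hv) (abs_wedge_le_four_mul_elen hv w)
    _ = 4 * (1 + elen w) := by ring

/-- Lengths of neighbouring points: `1 + |w| ≤ 3 (1 + |w − v|)` for `v ∈ nbr2 0`. -/
theorem one_add_elen_le_of_mem_nbr2 {v : Site 4} (hv : v ∈ nbr2 0) (w : Site 4) :
    1 + elen w ≤ 3 * (1 + elen (w - v)) := by
  have h := elen_le_elen_add_add (w - v) v
  rw [sub_add_cancel] at h
  have h2 := elen_le_two_of_mem_nbr2 hv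
  have h3 := elen_nonneg (w - v)
  have : elen w ≤ elen (w - v) + elen v := by
    have := elen_add_le (w - v) v; rwa [sub_add_cancel] at this
  linarith

/-! ## §2 The profile -/

/-- The profile at the origin is the free on-diagonal prefactor. -/
theorem gaussProfile_zero_right (c t : ℝ) : gaussProfile c t 0 = ((1 + t) ^ 2)⁻¹ := by
  simp [gaussProfile, elen_zero]

/-- The profile is bounded by its prefactor (for `c ≥ 0`, `t ≥ 0`). -/
theorem gaussProfile_le_inv {c t : ℝ} (hc : 0 ≤ c) (ht : 0 ≤ t) (w : Site 4) :
    gaussProfile c t w ≤ ((1 + t) ^ 2)⁻¹ := by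
  unfold gaussProfile
  have he := elen_nonneg w
  have hexp : Real.exp (-(c * elen w ^ 2 / (1 + t + elen w))) ≤ 1 := by
    rw [Real.exp_le_one_iff, neg_nonpos]
    positivity
  calc ((1 + t) ^ 2)⁻¹ * Real.exp (-(c * elen w ^ 2 / (1 + t + elen w)))
      ≤ ((1 + t) ^ 2)⁻¹ * 1 := by gcongr
    _ = ((1 + t) ^ 2)⁻¹ := mul_one _

/-- The profile is bounded by one (for `c ≥ 0`, `t ≥ 0`). -/
theorem gaussProfile_le_one {c t : ℝ} (hc : 0 ≤ c) (ht : 0 ≤ t) (w : Site 4) :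
    gaussProfile c t w ≤ 1 := by
  refine (gaussProfile_le_inv hc ht w).trans ?_
  rw [inv_le_one_iff₀]
  right; nlinarith

/-- Comparability in time on bounded intervals: for `0 ≤ u ≤ u₂`,
`Γ_c(u, x) ≤ (1 + u₂)² Γ_c(u₂, x)` (`c ≥ 0`). -/
theorem gaussProfile_le_of_le_time {c u u₂ : ℝ} (hc : 0 ≤ c) (hu : 0 ≤ u) (hu₂ : u ≤ u₂) (x : Site 4) :
    gaussProfile c u x ≤ (1 + u₂) ^ 2 * gaussProfile c u₂ x := by
  unfold gaussProfile
  have he := elen_nonneg x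
  have h1 : ((1 + u) ^ 2)⁻¹ ≤ 1 := by
    rw [inv_le_one_iff₀]; right; nlinarith
  have h2 : Real.exp (-(c * elen x ^ 2 / (1 + u + elen x))) ≤
      Real.exp (-(c * elen x ^ 2 / (1 + u₂ + elen x))) := by
    rw [Real.exp_le_exp, neg_le_neg_iff]
    apply div_le_div_of_nonneg_left (by positivity) (by positivity)
    linarith
  have h3 : (1 + u₂) ^ 2 * (((1 + u₂) ^ 2)⁻¹ * Real.exp (-(c * elen x ^ 2 / (1 + u₂ + elen x)))) =
      Real.exp (-(c * elen x ^ 2 / (1 + u₂ + elen x))) := by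
    have hpos : 0 < 1 + u₂ := by linarith
    have : (1 + u₂) ^ 2 ≠ 0 := by positivity
    rw [← mul_assoc, mul_inv_cancel₀ this, one_mul]
  rw [h3]
  calc ((1 + u) ^ 2)⁻¹ * Real.exp (-(c * elen x ^ 2 / (1 + u + elen x)))
      ≤ 1 * Real.exp (-(c * elen x ^ 2 / (1 + u₂ + elen x))) := by gcongr
    _ = _ := one_mul _

/-- Polynomial weights are absorbed by the profile: given the moment bound of the toolkit (3) for
`j`, `(1 + |w|)ʲ Γ_c(t,w) ≤ 2ʲ (1 + A) √(1+t)ʲ Γ_{(1−ε)c}(t,w)`. -/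
theorem one_add_elen_pow_mul_gaussProfile_le {c ε A : ℝ} {j : ℕ} (hc : 0 ≤ c) (hε : 0 ≤ ε)
    (hA : ∀ t : ℝ, 0 ≤ t → ∀ w : Site 4,
      elen w ^ j * gaussProfile c t w ≤ A * Real.sqrt (1 + t) ^ j * gaussProfile ((1 - ε) * c) t w)
    (t : ℝ) (ht : 0 ≤ t) (w : Site 4) :
    (1 + elen w) ^ j * gaussProfile c t w ≤
      2 ^ j * (1 + A) * Real.sqrt (1 + t) ^ j * gaussProfile ((1 - ε) * c) t w := by
  have he := elen_nonneg w
  have hΓ := gaussProfile_nonneg c t w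
  have hΓ' := gaussProfile_nonneg ((1 - ε) * c) t w
  have hmono : gaussProfile c t w ≤ gaussProfile ((1 - ε) * c) t w :=
    gaussProfile_anti (by nlinarith) ht w
  have hsqrt : 1 ≤ Real.sqrt (1 + t) := by
    rw [Real.one_le_sqrt]; linarith
  have hsj : 1 ≤ Real.sqrt (1 + t) ^ j := one_le_pow₀ hsqrt
  have hA0 : 0 ≤ A * Real.sqrt (1 + t) ^ j * gaussProfile ((1 - ε) * c) t w :=
    le_trans (by positivity) (hA t ht w)
  -- `(1 + x)^j ≤ 2^j max(1, x)^j ≤ 2^j (1 + x^j)`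
  have hpow : (1 + elen w) ^ j ≤ 2 ^ j * (1 + elen w ^ j) := by
    have : (1 + elen w) ^ j ≤ (2 * max 1 (elen w)) ^ j := by
      apply pow_le_pow_left₀ (by positivity)
      have := le_max_left 1 (elen w); have := le_max_right 1 (elen w); linarith
    refine this.trans ?_
    rw [mul_pow]
    gcongr
    rcases le_total 1 (elen w) with h | h
    · rw [max_eq_right h]; linarith
    · rw [max_eq_left h, one_pow]; have := pow_nonneg he j; linarith
  calc (1 + elen w) ^ j * gaussProfile c t w
      ≤ 2 ^ j * (1 + elen w ^ j) * gaussProfile c t w := by gcongr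
    _ = 2 ^ j * (gaussProfile c t w + elen w ^ j * gaussProfile c t w) := by ring
    _ ≤ 2 ^ j * (gaussProfile ((1 - ε) * c) t w +
          A * Real.sqrt (1 + t) ^ j * gaussProfile ((1 - ε) * c) t w) := by
        gcongr ?_ * (?_)
        exact add_le_add hmono (hA t ht w)
    _ ≤ 2 ^ j * (Real.sqrt (1 + t) ^ j * gaussProfile ((1 - ε) * c) t w +
          A * Real.sqrt (1 + t) ^ j * gaussProfile ((1 - ε) * c) t w) := by
        gcongr
        calc gaussProfile ((1 - ε) * c) t w = 1 * gaussProfile ((1 - ε) * c) t w := (one_mul _).symm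
          _ ≤ Real.sqrt (1 + t) ^ j * gaussProfile ((1 - ε) * c) t w := by gcongr
    _ = 2 ^ j * (1 + A) * Real.sqrt (1 + t) ^ j * gaussProfile ((1 - ε) * c) t w := by ring

/-! ## §3 The sharp Taylor bound of the cocycle -/

/-- Derivative of the truncated exponential series: `d/dx Σ_{j<m+1} xʲ/j! = Σ_{j<m} xʲ/j!`. -/
theorem hasDerivAt_expPartialSum (m : ℕ) (x : ℂ) :
    HasDerivAt (fun y : ℂ => ∑ j ∈ Finset.range (m + 1), y ^ j / (j.factorial : ℂ))
      (∑ j ∈ Finset.range m, x ^ j / (j.factorial : ℂ)) x := by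
  induction m with
  | zero =>
    simp only [zero_add, Finset.range_one, Finset.sum_singleton, pow_zero, Nat.factorial_zero,
      Nat.cast_one, div_one, Finset.range_zero, Finset.sum_empty]
    exact hasDerivAt_const x (1 : ℂ)
  | succ m ih =>
    have hfun : (fun y : ℂ => ∑ j ∈ Finset.range (m + 1 + 1), y ^ j / (j.factorial : ℂ)) =
        fun y : ℂ => (∑ j ∈ Finset.range (m + 1), y ^ j / (j.factorial : ℂ)) +
          y ^ (m + 1) / ((m + 1).factorial : ℂ) := by
      funext y; rw [Finset.sum_range_succ]
    rw [hfun, Finset.sum_range_succ]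
    refine ih.add ?_
    have h := (hasDerivAt_pow (m + 1) x).div_const ((m + 1).factorial : ℂ)
    refine h.congr_deriv ?_
    rw [Nat.add_sub_cancel, Nat.factorial_succ]
    push_cast
    have : ((m.factorial : ℂ)) ≠ 0 := by exact_mod_cast (Nat.factorial_pos m).ne'
    field_simp

/-- **Sharp Taylor bound of the cocycle**: for real `φ` and every order `m`,
`‖e^{iφ} − Σ_{j<m} (iφ)ʲ/j!‖ ≤ |φ|ᵐ` (no exponential loss, unlike the general complex bound). -/
theorem norm_cexp_mul_I_sub_sum_le (m : ℕ) (φ : ℝ) :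
    ‖Complex.exp ((φ : ℂ) * Complex.I) -
        ∑ j ∈ Finset.range m, ((φ : ℂ) * Complex.I) ^ j / (j.factorial : ℂ)‖ ≤ |φ| ^ m := by
  induction m generalizing φ with
  | zero =>
    simp only [Finset.range_zero, Finset.sum_empty, sub_zero, pow_zero, Complex.norm_exp_ofReal_mul_I,
      le_refl]
  | succ m ih =>
    -- `g(ψ) = e^{iψ} − Σ_{j<m+1} (iψ)ʲ/j!` has `g(0) = 0` and `g' = (previous remainder) · i`
    have hg0 : Complex.exp (((0 : ℝ) : ℂ) * Complex.I) -
        ∑ j ∈ Finset.range (m + 1), (((0 : ℝ) : ℂ) * Complex.I) ^ j / (j.factorial : ℂ) = 0 := by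
      simp only [Complex.ofReal_zero, zero_mul, Complex.exp_zero]
      rw [Finset.sum_eq_single 0]
      · simp
      · intro j _ hj; simp [zero_pow hj]
      · simp
    have hderiv : ∀ ψ : ℝ, HasDerivAt (fun ψ : ℝ => Complex.exp ((ψ : ℂ) * Complex.I) -
        ∑ j ∈ Finset.range (m + 1), ((ψ : ℂ) * Complex.I) ^ j / (j.factorial : ℂ))
        ((Complex.exp ((ψ : ℂ) * Complex.I) -
          ∑ j ∈ Finset.range m, ((ψ : ℂ) * Complex.I) ^ j / (j.factorial : ℂ)) * Complex.I) ψ := by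
      intro ψ
      have hlin : HasDerivAt (fun ψ : ℝ => (ψ : ℂ) * Complex.I) Complex.I ψ := by
        simpa using (Complex.ofRealCLM.hasDerivAt (x := ψ)).mul_const Complex.I
      have hF : HasDerivAt (fun x : ℂ => Complex.exp x -
          ∑ j ∈ Finset.range (m + 1), x ^ j / (j.factorial : ℂ))
          (Complex.exp ((ψ : ℂ) * Complex.I) -
            ∑ j ∈ Finset.range m, ((ψ : ℂ) * Complex.I) ^ j / (j.factorial : ℂ))
          ((ψ : ℂ) * Complex.I) :=
        (Complex.hasDerivAt_exp _).sub (hasDerivAt_expPartialSum m _)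
      exact hF.comp ψ hlin
    have hconv : Convex ℝ (Set.uIcc 0 φ) := convex_uIcc 0 φ
    have key := hconv.norm_image_sub_le_of_norm_hasDerivWithin_le
      (C := |φ| ^ m) (fun ψ _ => (hderiv ψ).hasDerivWithinAt) ?_
      (Set.left_mem_uIcc) (Set.right_mem_uIcc)
    · rw [hg0, sub_zero] at key
      refine key.trans ?_
      rw [sub_zero, Real.norm_eq_abs, pow_succ]
    · intro ψ hψ
      rw [norm_mul, Complex.norm_I, mul_one]
      refine (ih ψ).trans (pow_le_pow_left₀ (abs_nonneg ψ) ?_ m)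
      rcases Set.mem_uIcc.mp hψ with ⟨h1, h2⟩ | ⟨h1, h2⟩
      · rw [abs_of_nonneg h1]; exact h2.trans (le_abs_self φ)
      · rw [abs_le]; constructor
        · have := neg_abs_le φ; linarith
        · linarith [abs_nonneg φ]

/-! ## Registered headline -/

/-- Registered headline of this helper file (aux stub `stub_secondOrderExpansionAux` of crux
stmt-QuantumFields-16786, line `Sketch`): the sharp polynomial Taylor bound of the magnetic cocycle. -/
theorem stub_secondOrderExpansionAux : ∀ (m : ℕ) (φ : ℝ), ‖Complex.exp ((φ : ℂ) * Complex.I) - ∑ j ∈ Finset.range m, ((φ : ℂ) * Complex.I) ^ j / (j.factorial : ℂ)‖ ≤ |φ| ^ m :=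
  norm_cexp_mul_I_sub_sum_le

end Summit.QuantumFields.QCD.Cruxes.QuarkLoopCoefficient.Sketch.SecondOrderExpansion

end
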